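import Summits.QuantumFields.BalabanUV.T4Continuum.Support.DirichletCornerCutoutFar
import Summits.QuantumFields.BalabanUV.Beta.GAN24.DirichletBoxCompression

/-!
# `BalabanUV.T4Continuum.Support.DirichletCutoutFarPart` — NE2 (node U1a) formalisation swarm, sub-row `T4-U1a.S-NE2-D1-DIRICHLET°`, supplier item
# «Δ1-SKELETON» (file 11): THE FAR PART — for the `U = 1` scalar region Dirichlet solution `v = solExt n M a′ (blockReg S) w` on an
# ARBITRARY union of unit blocks and the cut-out field `z′ = (1 − etaC)·v`, the pure second differences of `z′` along EVERY axis obey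
# `‖∂_μᴴ∂_μ z′‖² ≤ 8n·A₁·A₂·‖w‖²` with `A₁, A₂` explicit in `(d, a′, n·ℓ)` — ONE power of `n` times polynomial losses in `n/R`
# (unit b2b-balaban-t4-ne2-formalise-leaf-08, gen 7, file 11)

HONEST FRAMING.  Rung (B)+1 bookkeeping at MODEL level (U = 1 scalar `Δ′ = Δ + a′Π′`, finite torus); [folklore]; NE2 (U1a) is NOT proved by
this file; spine PROVED 0/9 unchanged; NOT infinite volume, NOT the mass gap, NOT Clay.  HONEST DEPENDENCY (verbatim): «continuum YM on T⁴ ⇐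
BetaPertH ∧ nine spine estimates (0/9 proved); BetaPertH ⇐ (D1) ∧ (D4) ∧ CAP+tail; G-an2-4 gates asym, D1 and NE2/3/4.»

WHAT THIS FILE PROVES (0 sorry; files 1, 3, 7, 9, 10 and gan24-p2's `DirichletBoxCompression` BY NAME).  §1 `relSmoothIn_one_sub_etaC`: the
complementary cut-out `1 − etaC` is (intrinsically) smooth w.r.t. any field, constants `ell1C, ell2C`.  §2 the three ROOT BUDGETS of
`z′ = cut (1 − etaC) v`, `v = solExt`: `√E(z′) ≤ A_E √‖w‖²`, `√‖z′‖² ≤ γ′⁻¹ √‖w‖²`, `√(Σ_Ω |Δz′|²) ≤ A_Δ √‖w‖²`.  §3 **`nsq_sdiffH_sdiff_cutout_le`**: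
`‖∂_μᴴ∂_μ z′‖² ≤ 8n·√(2A_E² + 2d(n·ell1)²γ′⁻²)·(A_Δ + d(2(n·ell1)A_E + (n²·ell2)γ′⁻¹))·‖w‖²` for EVERY axis `μ`, every block set `S`,
every `d`, every torus (`2 ≤ R`, `4R ≤ n`, `2R + 2 ≤ R′`, `2(R′ + R) ≤ n`), by file 1's END with `ψ_μ = psiS` (admissible: file 3;
intrinsically smooth w.r.t. `z′`: file 10).

ABSOLUTE RULE (cell, verbatim): «No internally-minted statement may enter as a cited fact. Every hypothesis is either kernel-proved in
this package or a verbatim quotation of a PUBLISHED theorem with page reference. The manuscript(s) under audit are NOT citable for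
their own disputed steps — they are the thing under adjudication; programme-internal (2001/route/tribunal) claims are never citable.»
[folklore]; data definitions (constants) only; no `def … : Prop` fact.  NOT CLAIMED: the near part (decay on the cut-out), the two-level law;
NE2; NE3.
-/

noncomputable section

open scoped BigOperators ComplexConjugate Matrix
open Finset

namespace Summit.QuantumFields.BalabanUV.T4Continuum.DirichletCutoutFarPart

open Literature.MathematicalPhysics.QuantumFieldTheory.Balaban1983to89.B5Prop11Plancherel (Tor fine unitVec)
open Literature.MathematicalPhysics.QuantumFieldTheory.Balaban1983to89.B5Action121 (sdiff LapS)
open Literature.MathematicalPhysics.QuantumFieldTheory.Balaban1983to89.B5Prop11Lower (nsq nsq_nonneg)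
open Summit.QuantumFields.BalabanUV.Beta.GAN24.DirichletBoxTrace (blockReg)
open Summit.QuantumFields.BalabanUV.Beta.GAN24.DirichletBoxCompression (solExt solExt_apply_of_not dirichlet_solExt_le nsq_solExt_le
  sum_normSq_LapS_solExt_le nsq_sdiff_solExt_le)
open Summit.QuantumFields.BalabanUV.T4Continuum.ScalarAveragedPropagator (gammaPs gammaPs_pos)
open Summit.QuantumFields.BalabanUV.T4Continuum.DirichletDirectionalBesov (restrictTo nsqOn nsq_restrictTo)
open Summit.QuantumFields.BalabanUV.T4Continuum.DirichletDirectionalBesovCutoff (cut energy nsq_sdiff_le_energy)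
open Summit.QuantumFields.BalabanUV.T4Continuum.DirichletRelativeBesovIntrinsic (RelSmoothIn energy_cut_le_in sqrt_nsq_restrict_LapS_cut_le_in
  nsq_sdiffH_sdiff_le_in)
open Summit.QuantumFields.BalabanUV.T4Continuum.ScaleProfile (lip1 lip2 lip1_nonneg lip2_nonneg)
open Summit.QuantumFields.BalabanUV.T4Continuum.DirichletDipCutoff (psiS psiS_eq_zero psiS_eq_one)
open Summit.QuantumFields.BalabanUV.T4Continuum.DirichletDipCutoffSmooth (ell1 ell2)
open Summit.QuantumFields.BalabanUV.T4Continuum.DirichletCornerCutoutEta (etaC etaC_mem etaC_step etaC_second ell1C ell2C)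
open Summit.QuantumFields.BalabanUV.T4Continuum.DirichletCornerCutoutFar (psiS_relSmoothIn_cutout)

variable {d : ℕ} (n : ℕ) [NeZero n] (M : Fin d → ℕ) [hM : ∀ μ, NeZero (M μ)] (S : Tor M → Prop) [DecidablePred S] (μ : Fin d) (R R' : ℕ)

/-! ## §1 The complementary cut-out is smooth -/

section Eta

variable {n M S μ R R'} (hR : 2 ≤ R) (hR' : 2 ≤ R') (hn : 2 * (R' + R) ≤ n)
include hR hR' hn

/-- `1 − etaC` is intrinsically smooth with respect to ANY field on ANY region (it is globally smooth). [folklore] -/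
theorem relSmoothIn_one_sub_etaC (Ω : Tor (fine n M) → Prop) (z : Tor (fine n M) → ℂ) :
    RelSmoothIn (fine n M) Ω z (fun x => 1 - etaC n M S μ R R' x) (ell1C d R) (ell2C d R) where
  nonneg x := by linarith [(etaC_mem hR hn (S := S) (μ := μ) x).2]
  le_one x := by linarith [(etaC_mem hR hn (S := S) (μ := μ) x).1]
  ell1_nonneg := by have := lip1_nonneg hR; unfold ell1C; positivity
  ell2_nonneg := by have := lip1_nonneg hR; have : 0 ≤ lip2 R := lip2_nonneg; unfold ell2C ell1C; positivity
  lip x ν _ _ := by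
    refine ⟨fun _ => ?_, fun _ => ?_⟩
    · rw [show (1 - etaC n M S μ R R' (x + unitVec (fine n M) ν)) - (1 - etaC n M S μ R R' x)
          = -(etaC n M S μ R R' (x + unitVec (fine n M) ν) - etaC n M S μ R R' x) by ring, abs_neg]
      exact etaC_step hR hR' hn ν x
    · have := etaC_step hR hR' hn (S := S) (μ := μ) ν (x - unitVec (fine n M) ν)
      rw [sub_add_cancel] at this
      rw [show (1 - etaC n M S μ R R' x) - (1 - etaC n M S μ R R' (x - unitVec (fine n M) ν))
          = -(etaC n M S μ R R' x - etaC n M S μ R R' (x - unitVec (fine n M) ν)) by ring, abs_neg]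
      exact this
  lip₂ x ν _ _ _ _ := by
    rw [show 2 * (1 - etaC n M S μ R R' x) - (1 - etaC n M S μ R R' (x + unitVec (fine n M) ν)) - (1 - etaC n M S μ R R' (x - unitVec (fine n M) ν))
        = -(2 * etaC n M S μ R R' x - etaC n M S μ R R' (x + unitVec (fine n M) ν) - etaC n M S μ R R' (x - unitVec (fine n M) ν)) by ring, abs_neg]
    exact etaC_second hR hR' hn ν x

end Eta

/-! ## §2 The root budgets of the cut-out field -/

/-- the energy constant `A_E = √(2γ′⁻¹ + 2d·(n·ell1C)²·γ′⁻²)`. [folklore] -/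
def AE (d : ℕ) (a' : ℝ) (n R : ℕ) : ℝ := Real.sqrt (2 * (gammaPs d a')⁻¹ + 2 * d * ((n : ℝ) * ell1C d R) ^ 2 * (gammaPs d a')⁻¹ ^ 2)

/-- the Laplacian constant `A_Δ = √(2(1 + (a′γ′⁻¹)²)) + d·(2(n·ell1C)√γ′⁻¹ + (n²·ell2C)γ′⁻¹)`. [folklore] -/
def AD (d : ℕ) (a' : ℝ) (n R : ℕ) : ℝ :=
  Real.sqrt (2 * (1 + (a' * (gammaPs d a')⁻¹) ^ 2)) + d * (2 * ((n : ℝ) * ell1C d R) * Real.sqrt ((gammaPs d a')⁻¹) + ((n : ℝ) ^ 2 * ell2C d R) * (gammaPs d a')⁻¹)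

/-- the first factor of the END: `A₁ = √(2A_E² + 2d(n·ell1)²γ′⁻²)`. [folklore] -/
def A1 (d : ℕ) (a' : ℝ) (n R : ℕ) : ℝ := Real.sqrt (2 * AE d a' n R ^ 2 + 2 * d * ((n : ℝ) * ell1 d R) ^ 2 * (gammaPs d a')⁻¹ ^ 2)

/-- the second factor of the END: `A₂ = A_Δ + d(2(n·ell1)A_E + (n²·ell2)γ′⁻¹)`. [folklore] -/
def A2 (d : ℕ) (a' : ℝ) (n R : ℕ) : ℝ := AD d a' n R + d * (2 * ((n : ℝ) * ell1 d R) * AE d a' n R + ((n : ℝ) ^ 2 * ell2 d R) * (gammaPs d a')⁻¹)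

section Budgets

variable {n M S μ R R'} (hR : 2 ≤ R) (hR' : 2 ≤ R') (hn : 2 * (R' + R) ≤ n) {a' : ℝ} (ha' : 0 < a')
include hR hR' hn ha'

/-- **energy root budget** of the cut-out field. [folklore] -/
theorem sqrt_energy_cutout_le (w : {x // blockReg n M S x} → ℂ) :
    Real.sqrt (energy (fine n M) (n : ℂ) (cut (fine n M) (fun x => 1 - etaC n M S μ R R' x) (solExt n M a' (blockReg n M S) w)))
      ≤ AE d a' n R * Real.sqrt (nsq w) := by
  have hγ := (gammaPs_pos (d := d) (a' := a')).1
  set v := solExt n M a' (blockReg n M S) w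
  have hz : ∀ x, ¬ blockReg n M S x → v x = 0 := fun x hx => solExt_apply_of_not n M a' _ w hx
  have h1 := energy_cut_le_in (fine n M) (n : ℂ) (relSmoothIn_one_sub_etaC hR hR' hn (S := S) (μ := μ) (R' := R') (blockReg n M S) v) hz
  have hE : energy (fine n M) (n : ℂ) v ≤ (gammaPs d a')⁻¹ * nsq w := dirichlet_solExt_le n M a' _ ha' w
  have hZ : nsq v ≤ (gammaPs d a')⁻¹ ^ 2 * nsq w := nsq_solExt_le n M a' _ ha' w
  rw [AE, ← Real.sqrt_mul' _ (nsq_nonneg w)]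
  refine Real.sqrt_le_sqrt (h1.trans ?_)
  rw [Complex.norm_natCast]
  have hd : (0 : ℝ) ≤ d := Nat.cast_nonneg d
  nlinarith [hE, hZ, mul_nonneg hd (sq_nonneg ((n : ℝ) * ell1C d R)), nsq_nonneg w, sq_nonneg (ell1C d R)]

omit hR' in
/-- **mass root budget** of the cut-out field. [folklore] -/
theorem sqrt_nsq_cutout_le (w : {x // blockReg n M S x} → ℂ) :
    Real.sqrt (nsq (cut (fine n M) (fun x => 1 - etaC n M S μ R R' x) (solExt n M a' (blockReg n M S) w)))
      ≤ (gammaPs d a')⁻¹ * Real.sqrt (nsq w) := by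
  have hγ := (gammaPs_pos (d := d) (a' := a')).1
  have hZ := nsq_solExt_le n M a' (blockReg n M S) ha' w
  have hcut : nsq (cut (fine n M) (fun x => 1 - etaC n M S μ R R' x) (solExt n M a' (blockReg n M S) w))
      ≤ nsq (solExt n M a' (blockReg n M S) w) := by
    refine Finset.sum_le_sum fun x _ => ?_
    have h01 := etaC_mem hR hn (S := S) (μ := μ) (R' := R') x
    have ha : |1 - etaC n M S μ R R' x| ≤ 1 := by rw [abs_le]; constructor <;> linarith [h01.1, h01.2]
    have hpt : ‖cut (fine n M) (fun x => 1 - etaC n M S μ R R' x) (solExt n M a' (blockReg n M S) w) x‖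
        ≤ ‖solExt n M a' (blockReg n M S) w x‖ := by
      simp only [cut, norm_mul, Complex.norm_real, Real.norm_eq_abs]
      exact mul_le_of_le_one_left (norm_nonneg _) ha
    exact pow_le_pow_left₀ (norm_nonneg _) hpt 2
  rw [← Real.sqrt_sq (inv_nonneg.mpr hγ.le), ← Real.sqrt_mul (sq_nonneg _)]
  exact Real.sqrt_le_sqrt (hcut.trans hZ)

/-- **Laplacian root budget** of the cut-out field (restricted to the region). [folklore] -/
theorem sqrt_nsqOn_LapS_cutout_le (w : {x // blockReg n M S x} → ℂ) :
    Real.sqrt (nsqOn (blockReg n M S) (LapS (fine n M) (n : ℂ) *ᵥ cut (fine n M) (fun x => 1 - etaC n M S μ R R' x) (solExt n M a' (blockReg n M S) w)))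
      ≤ AD d a' n R * Real.sqrt (nsq w) := by
  have hγ := (gammaPs_pos (d := d) (a' := a')).1
  have hc : ((n : ℕ) : ℂ) ≠ 0 := by exact_mod_cast NeZero.ne n
  set v := solExt n M a' (blockReg n M S) w
  have hz : ∀ x, ¬ blockReg n M S x → v x = 0 := fun x hx => solExt_apply_of_not n M a' _ w hx
  have h1 := sqrt_nsq_restrict_LapS_cut_le_in (fine n M) (n : ℂ) hc
    (relSmoothIn_one_sub_etaC hR hR' hn (S := S) (μ := μ) (R' := R') (blockReg n M S) v) hz
  rw [nsq_restrictTo] at h1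
  refine h1.trans ?_
  rw [Complex.norm_natCast]
  set W := Real.sqrt (nsq w)
  have hW0 : 0 ≤ W := Real.sqrt_nonneg _
  have hA : Real.sqrt (nsqOn (blockReg n M S) (LapS (fine n M) (n : ℂ) *ᵥ v)) ≤ Real.sqrt (2 * (1 + (a' * (gammaPs d a')⁻¹) ^ 2)) * W := by
    rw [← Real.sqrt_mul (by positivity)]
    exact Real.sqrt_le_sqrt (sum_normSq_LapS_solExt_le n M a' _ ha' w)
  have he : ∀ ν, Real.sqrt (nsq (sdiff (fine n M) (n : ℂ) ν *ᵥ v)) ≤ Real.sqrt ((gammaPs d a')⁻¹) * W := fun ν => by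
    rw [← Real.sqrt_mul (inv_nonneg.mpr hγ.le)]; exact Real.sqrt_le_sqrt (nsq_sdiff_solExt_le n M a' _ ha' w ν)
  have hZ' : Real.sqrt (nsq v) ≤ (gammaPs d a')⁻¹ * W := by
    rw [← Real.sqrt_sq (inv_nonneg.mpr hγ.le), ← Real.sqrt_mul (sq_nonneg _)]
    exact Real.sqrt_le_sqrt (nsq_solExt_le n M a' _ ha' w)
  have hl1 : 0 ≤ ell1C d R := by have := lip1_nonneg hR; unfold ell1C; positivity
  have hl2 : 0 ≤ ell2C d R := by have := lip1_nonneg hR; have : 0 ≤ lip2 R := lip2_nonneg; unfold ell2C ell1C; positivity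
  have hterm : ∀ ν : Fin d, 2 * (n : ℝ) * ell1C d R * Real.sqrt (nsq (sdiff (fine n M) (n : ℂ) ν *ᵥ v)) + (n : ℝ) ^ 2 * ell2C d R * Real.sqrt (nsq v)
      ≤ (2 * ((n : ℝ) * ell1C d R) * Real.sqrt ((gammaPs d a')⁻¹) + ((n : ℝ) ^ 2 * ell2C d R) * (gammaPs d a')⁻¹) * W := by
    intro ν
    have hn0 : (0 : ℝ) ≤ n := Nat.cast_nonneg n
    nlinarith [he ν, hZ', mul_nonneg hn0 hl1, mul_nonneg (sq_nonneg (n : ℝ)) hl2]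
  calc Real.sqrt (nsqOn (blockReg n M S) (LapS (fine n M) (n : ℂ) *ᵥ v))
        + ∑ ν : Fin d, (2 * (n : ℝ) * ell1C d R * Real.sqrt (nsq (sdiff (fine n M) (n : ℂ) ν *ᵥ v)) + (n : ℝ) ^ 2 * ell2C d R * Real.sqrt (nsq v))
      ≤ Real.sqrt (2 * (1 + (a' * (gammaPs d a')⁻¹) ^ 2)) * W
        + ∑ _ν : Fin d, (2 * ((n : ℝ) * ell1C d R) * Real.sqrt ((gammaPs d a')⁻¹) + ((n : ℝ) ^ 2 * ell2C d R) * (gammaPs d a')⁻¹) * W :=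
        add_le_add hA (Finset.sum_le_sum fun ν _ => hterm ν)
    _ = AD d a' n R * W := by rw [Finset.sum_const, Finset.card_univ, Fintype.card_fin, nsmul_eq_mul, AD]; ring

end Budgets

/-! ## §3 THE FAR-PART END -/

section End

variable {n M S R R'} (hR : 2 ≤ R) (hn4 : 4 * R ≤ n) (hRR : 2 * R + 2 ≤ R') (hn : 2 * (R' + R) ≤ n) {a' : ℝ} (ha' : 0 < a')
include hR hn4 hRR hn ha'

/-- **THE FAR PART**: for every axis `μ`, every block set `S`, `v = solExt n M a′ (blockReg S) w`, `z′ = (1 − etaC)·v`: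
`‖∂_μᴴ∂_μ z′‖² ≤ 8n·A₁·A₂·‖w‖²`. [folklore] -/
theorem nsq_sdiffH_sdiff_cutout_le (μ : Fin d) (w : {x // blockReg n M S x} → ℂ) :
    nsq ((sdiff (fine n M) (n : ℂ) μ)ᴴ *ᵥ (sdiff (fine n M) (n : ℂ) μ *ᵥ
        cut (fine n M) (fun x => 1 - etaC n M S μ R R' x) (solExt n M a' (blockReg n M S) w)))
      ≤ 8 * n * A1 d a' n R * A2 d a' n R * nsq w := by
  have hR' : 2 ≤ R' := by omega
  have hγ := (gammaPs_pos (d := d) (a' := a')).1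
  have hc : ((n : ℕ) : ℂ) ≠ 0 := by exact_mod_cast NeZero.ne n
  set v := solExt n M a' (blockReg n M S) w with hv
  set z := cut (fine n M) (fun x => 1 - etaC n M S μ R R' x) v with hzdef
  have hvz : ∀ x, ¬ blockReg n M S x → v x = 0 := fun x hx => solExt_apply_of_not n M a' _ w hx
  have hz : ∀ x, ¬ blockReg n M S x → z x = 0 := fun x hx => by simp only [hzdef, cut, hvz x hx, mul_zero]
  -- admissibility of `ψ_μ` where `z ≠ 0` (in fact at every exposed site of the region)
  have hzero : ∀ x, blockReg n M S x → ¬ blockReg n M S (x - unitVec (fine n M) μ) → z x ≠ 0 → psiS n M S μ R x = 0 :=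
    fun x hx hx' _ => psiS_eq_zero hR hx hx'
  have hone : ∀ x, blockReg n M S x → ¬ blockReg n M S (x + unitVec (fine n M) μ) → z x ≠ 0 → psiS n M S μ R x = 1 :=
    fun x hx hx' _ => psiS_eq_one hR hn4 hx hx'
  have hψ := psiS_relSmoothIn_cutout (S := S) (μ := μ) hR hRR hn hn4 v
  have hmain := nsq_sdiffH_sdiff_le_in (fine n M) hψ hzero hone (n : ℂ) hc hz
  refine hmain.trans ?_
  rw [Complex.norm_natCast]
  -- the root budgets
  set W := Real.sqrt (nsq w) with hW
  have hW0 : 0 ≤ W := Real.sqrt_nonneg _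
  have hW2 : W ^ 2 = nsq w := Real.sq_sqrt (nsq_nonneg w)
  have hE := sqrt_energy_cutout_le hR hR' hn ha' (S := S) (μ := μ) w
  have hZ := sqrt_nsq_cutout_le hR hn ha' (S := S) (μ := μ) w
  have hL := sqrt_nsqOn_LapS_cutout_le hR hR' hn ha' (S := S) (μ := μ) w
  rw [← hv, ← hzdef] at hE hZ hL
  have hAE : 0 ≤ AE d a' n R := Real.sqrt_nonneg _
  have hl1 : 0 ≤ ell1 d R := by have := lip1_nonneg hR; unfold ell1; positivity
  have hl2 : 0 ≤ ell2 d R := by have := lip1_nonneg hR; have : 0 ≤ lip2 R := lip2_nonneg; unfold ell2 ell1; positivity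
  have he : ∀ ν, Real.sqrt (nsq (sdiff (fine n M) (n : ℂ) ν *ᵥ z)) ≤ AE d a' n R * W := fun ν =>
    (Real.sqrt_le_sqrt (nsq_sdiff_le_energy (fine n M) (n : ℂ) ν z)).trans hE
  -- first factor
  have h1 : Real.sqrt (2 * energy (fine n M) (n : ℂ) z + 2 * d * (n : ℝ) ^ 2 * ell1 d R ^ 2 * nsq z) ≤ A1 d a' n R * W := by
    rw [A1, hW, ← Real.sqrt_mul' _ (nsq_nonneg w)]
    refine Real.sqrt_le_sqrt ?_
    have hE2 : energy (fine n M) (n : ℂ) z ≤ AE d a' n R ^ 2 * nsq w := by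
      have := pow_le_pow_left₀ (Real.sqrt_nonneg _) hE 2
      rw [Real.sq_sqrt (DirichletDirectionalBesovCutoff.energy_nonneg _ _ _), mul_pow, hW2] at this; exact this
    have hZ2 : nsq z ≤ (gammaPs d a')⁻¹ ^ 2 * nsq w := by
      have := pow_le_pow_left₀ (Real.sqrt_nonneg _) hZ 2
      rw [Real.sq_sqrt (nsq_nonneg _), mul_pow, hW2] at this; exact this
    have hd : (0 : ℝ) ≤ d := Nat.cast_nonneg d
    nlinarith [hE2, hZ2, mul_nonneg hd (sq_nonneg ((n : ℝ) * ell1 d R)), nsq_nonneg w]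
  -- second factor
  have h2 : Real.sqrt (nsqOn (blockReg n M S) (LapS (fine n M) (n : ℂ) *ᵥ z))
        + ∑ ν : Fin d, (2 * (n : ℝ) * ell1 d R * Real.sqrt (nsq (sdiff (fine n M) (n : ℂ) ν *ᵥ z)) + (n : ℝ) ^ 2 * ell2 d R * Real.sqrt (nsq z))
      ≤ A2 d a' n R * W := by
    have hterm : ∀ ν : Fin d, 2 * (n : ℝ) * ell1 d R * Real.sqrt (nsq (sdiff (fine n M) (n : ℂ) ν *ᵥ z)) + (n : ℝ) ^ 2 * ell2 d R * Real.sqrt (nsq z)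
        ≤ (2 * ((n : ℝ) * ell1 d R) * AE d a' n R + ((n : ℝ) ^ 2 * ell2 d R) * (gammaPs d a')⁻¹) * W := by
      intro ν
      have hn0 : (0 : ℝ) ≤ n := Nat.cast_nonneg n
      nlinarith [he ν, hZ, mul_nonneg hn0 hl1, mul_nonneg (sq_nonneg (n : ℝ)) hl2]
    calc Real.sqrt (nsqOn (blockReg n M S) (LapS (fine n M) (n : ℂ) *ᵥ z))
          + ∑ ν : Fin d, (2 * (n : ℝ) * ell1 d R * Real.sqrt (nsq (sdiff (fine n M) (n : ℂ) ν *ᵥ z)) + (n : ℝ) ^ 2 * ell2 d R * Real.sqrt (nsq z))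
        ≤ AD d a' n R * W + ∑ _ν : Fin d, (2 * ((n : ℝ) * ell1 d R) * AE d a' n R + ((n : ℝ) ^ 2 * ell2 d R) * (gammaPs d a')⁻¹) * W :=
          add_le_add hL (Finset.sum_le_sum fun ν _ => hterm ν)
      _ = A2 d a' n R * W := by rw [Finset.sum_const, Finset.card_univ, Fintype.card_fin, nsmul_eq_mul, A2]; ring
  have hA1 : 0 ≤ A1 d a' n R := Real.sqrt_nonneg _
  have h20 : 0 ≤ Real.sqrt (nsqOn (blockReg n M S) (LapS (fine n M) (n : ℂ) *ᵥ z))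
      + ∑ ν : Fin d, (2 * (n : ℝ) * ell1 d R * Real.sqrt (nsq (sdiff (fine n M) (n : ℂ) ν *ᵥ z)) + (n : ℝ) ^ 2 * ell2 d R * Real.sqrt (nsq z)) :=
    add_nonneg (Real.sqrt_nonneg _) (Finset.sum_nonneg fun ν _ => by positivity)
  calc 8 * (n : ℝ) * Real.sqrt (2 * energy (fine n M) (n : ℂ) z + 2 * d * (n : ℝ) ^ 2 * ell1 d R ^ 2 * nsq z)
        * (Real.sqrt (nsqOn (blockReg n M S) (LapS (fine n M) (n : ℂ) *ᵥ z))
          + ∑ ν : Fin d, (2 * (n : ℝ) * ell1 d R * Real.sqrt (nsq (sdiff (fine n M) (n : ℂ) ν *ᵥ z)) + (n : ℝ) ^ 2 * ell2 d R * Real.sqrt (nsq z)))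
      ≤ 8 * (n : ℝ) * (A1 d a' n R * W) * (A2 d a' n R * W) := by
        apply mul_le_mul (mul_le_mul_of_nonneg_left h1 (by positivity)) h2 h20
        positivity
    _ = 8 * n * A1 d a' n R * A2 d a' n R * nsq w := by rw [← hW2]; ring

end End

end Summit.QuantumFields.BalabanUV.T4Continuum.DirichletCutoutFarPart

end
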